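import Literature.IUT.LogThetaLattice.RealifiedSemisimplificationProofsC
import Literature.MeasureTheory.Lebesgue.VitaliSet
import HarnessLib

/-!
# [IUTchIII] Remark 3.9.4 (vi), the LITERAL typing `Remark394vi_expPreservesVolume` (FACT row F-0432):
# REFUTED at the archimedean model of record — F-0432 DECIDED as typed

Proof-only companion (abc-iut cell, L6 home [IUTchII]/[IUTchIII]; L-F register row LF6-47 of
`plan/L6/LF-IUT.tsv`, FACT-LIST row F-0432 `Remark394vi_expPreservesVolume`; DAG node
IUTchIII:Rmk3.9.4(vi), itself discharged in the CORRECTED typing, p439470) of abc-iut-L6-t4's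
`Literature/IUT/LogThetaLattice/RealifiedSemisimplification.lean` (S. Mochizuki, *Inter-universal
Teichmüller theory III*, kurims manuscript (May 2020), §3, Remark 3.9.4 (vi), p. 125 l. 36 – p. 126 l. 40:
the diagram `|k| ↞ k ⊇ 𝒪^×_k ←^{exp_k} log_k(𝒪^×_k) ⊆ k ↠ |k|` at an archimedean `k ≅ ℂ` "induces
`ℝ_{>0}`-equivariant isomorphisms of monoids on the respective realified semi-simplifications … compatible
with the [radial/angular] log-volume map of [AbsTopIII], Proposition 5.7, (ii), (a)", "by considering
ample `S ⊆ log_k(𝒪^×_k)` that map bijectively to `exp_k(S) ⊆ 𝒪^×_k`"; claim key Mochizuki2012, DISPUTED,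
D-0012 — the content decided here is undisputed Lebesgue measure theory).  NO definitions, NO instances,
NO new `Prop` facts; the landed modules are not edited.

THE TWO TYPINGS.  abc-iut-L6-t4's statement file carries
* the LITERAL row F-0432 `Remark394vi_expPreservesVolume L expk volAng volLin :=
  ∀ S ⊆ L, InjOn expk S → volAng (expk '' S) = volLin S` — hypothesis-free in `S`, flagged in its own
  docstring (finding of abc-iut-L6-d4) as a recorded MIS-TYPING ("classically FALSE for non-measurable `S`"),
  and
* the CORRECTED row `Remark394vi_expPreservesVolume'` (compact `S`, print's "ample"), PROVED at the
  archimedean model of record `k = ℂ`, `L = iℝ = log_k(𝒪^×_k)`, `expk = exp`, `volAng = ENNReal.ofReal ∘ μ̆_k`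
  (abc-iut-L4-t3's angular volume `ComplexVolume.angularVolume`, [AbsTopIII] Prop. 5.7 (ii)(a)),
  `volLin S = volume (im '' S)` (Lebesgue measure along `iℝ`) by abc-iut-L6-d4
  (`Remark394vi_expPreservesVolume'_holds`, p407046).

THIS FILE decides the literal row AT THE SAME MODEL: it is FALSE there
(`not_Remark394vi_expPreservesVolume_arch`), so F-0432 reads «literal form REFUTED-AT-MODEL, corrected
form PROVED» (`Remark394vi_label_decided_arch`).  The L-F register (LF6-47, 2026-08-27) had recorded the
kernel refuter as ABSENT on the grounds that it needs a non-Lebesgue-measurable set, "which Mathlib at this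
tree does not provide"; Mathlib indeed does not, but the TREE does: Vitali's transversal of `ℝ/ℚ`
(`Literature.MeasureTheory.Lebesgue.Vitali.exists_transversal`, Wheeden–Zygmund Thm. (3.38)), which makes
the refutation short.

THE WITNESS (`exists_injOn_exp_volume_im_eq_top`).  Let `V ⊆ (0,1)` meet every coset of `ℚ` in exactly
one point, `q_k := 1/(k+2) ∈ ℚ` (`k ∈ ℕ`, pairwise distinct) and
`T := ⋃_k (V + 2πk + q_k) ⊆ ℝ`, `S := i·T ⊆ iℝ`.
* `exp` is injective on `S`: `exp(ia) = exp(ib)` forces `a - b ∈ 2πℤ`; writing `a = v + 2πk + q_k`,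
  `b = w + 2πj + q_j` with `v, w ∈ V ⊆ (0,1)` gives `|v - w + q_k - q_j| < 2 < 2π`, so the `2πℤ`-part vanishes,
  `w - v ∈ ℚ`, hence `w = v` (transversality), `q_k = q_j`, `k = j`, `a = b`.
* `volume (im '' S) = volume T = ∞`: the pieces `V + 2πk + q_k` lie in the pairwise disjoint Borel windows
  `W_k = [2πk, 2πk + 2)`, so `volume T ≥ (volume.restrict T)(⋃_k W_k) = Σ_k volume (W_k ∩ T) ≥ Σ_k volume (V + c_k)
  = Σ_k volume V` (outer Lebesgue measure is translation invariant on ALL sets), and `volume V ≠ 0` because the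
  countably many rational translates of `V` cover `ℝ`.
* but `volAng (exp '' S) = ENNReal.ofReal (μ̆_k (exp S))` is a real number (indeed `μ̆_k ≤ 2π` always,
  `angularVolume_le_two_pi`): `≠ ∞`.
Hence NO `∞`-free `volAng` whatsoever satisfies the literal row along `(iℝ, exp, Lebesgue)`
(`not_Remark394vi_expPreservesVolume_imAxis_of_ne_top`); the failure is the classical one — outer measure
is not additive across the non-measurable pieces once they are wrapped onto the circle, while it IS additive
across the disjoint measurable windows on the line.

Honest framing: statements about OUR typing at OUR archimedean model; the node IUTchIII:Rmk3.9.4(vi) keeps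
its status (discharged in the corrected typing); nothing here bears on [IUTchIII] Cor. 3.12 or asserts abc
proved or refuted; no side taken; typed ≠ proved for the disputed corpus.
-/

set_option autoImplicit false

noncomputable section

open MeasureTheory MeasureTheory.Measure Set
open scoped ENNReal

namespace Literature.IUT.LogThetaLattice

open Literature.AnabelianGeometry.AbsoluteAnabelian

/-! ### 1. A Vitali transversal has positive outer Lebesgue measure -/

/-- A set of reals whose rational translates cover the line is not Lebesgue-null (outer measure): the
countably many translates `V - q`, `q ∈ ℚ`, all have the outer measure of `V` and cover `ℝ`, whose measure
is `∞`.  (Wheeden–Zygmund, proof of Thm. (3.38).) [cite: WheedenWheedenZygmund1977, Thm. (3.38)] -/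
theorem volume_ne_zero_of_rat_translates_cover {V : Set ℝ}
    (hcov : ∀ x : ℝ, ∃ v ∈ V, ∃ q : ℚ, x = v + q) : volume V ≠ 0 := by
  intro hV0
  -- the translates `{x | x - q ∈ V}` are null and cover `ℝ`
  have hnull : ∀ q : ℚ, volume ((fun x : ℝ => x + (-(q : ℝ))) ⁻¹' V) = 0 := fun q => by
    rw [measure_preimage_add_right]; exact hV0
  have hcover : (univ : Set ℝ) ⊆ ⋃ q : ℚ, (fun x : ℝ => x + (-(q : ℝ))) ⁻¹' V := by
    intro x _
    obtain ⟨v, hv, q, rfl⟩ := hcov x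
    refine mem_iUnion.2 ⟨q, ?_⟩
    show v + (q : ℝ) + -(q : ℝ) ∈ V
    simpa using hv
  have h0 : volume (univ : Set ℝ) = 0 := measure_mono_null hcover (measure_iUnion_null hnull)
  simp at h0

/-! ### 2. The witness: a subset of `iℝ` on which `exp` is injective, of infinite linear measure -/

/-- **The refuting witness for the literal F-0432.**  There is a subset `S` of the imaginary axis on which
the complex exponential is injective but whose projection to `ℝ` has infinite (outer) Lebesgue measure:
`S = i·⋃_k (V + 2πk + 1/(k+2))` for a Vitali transversal `V ⊆ (0,1)` of `ℝ/ℚ`.  Classical (Vitali 1905 /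
Wheeden–Zygmund Thm. (3.38)); necessarily non-measurable, since a measurable partial transversal of
`ℝ → ℝ/2πℤ` has measure `≤ 2π`. [cite: WheedenWheedenZygmund1977, Thm. (3.38)] -/
theorem exists_injOn_exp_volume_im_eq_top :
    ∃ S : Set ℂ, S ⊆ {z : ℂ | z.re = 0} ∧ Set.InjOn Complex.exp S ∧
      volume (Complex.im '' S) = ⊤ := by
  obtain ⟨V, hVI, hcov, huniq⟩ :=
    Literature.MeasureTheory.Lebesgue.Vitali.exists_transversal 0 (δ := 1) one_pos
  have hVpos : volume V ≠ 0 := volume_ne_zero_of_rat_translates_cover hcov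
  -- the shifts `c k = 2πk + 1/(k+2)` and the pieces `B k = V + c k`
  set c : ℕ → ℝ := fun k => 2 * Real.pi * k + 1 / ((k : ℝ) + 2) with hc
  set B : ℕ → Set ℝ := fun k => (fun x : ℝ => x + (-(c k))) ⁻¹' V with hB
  set T : Set ℝ := ⋃ k, B k with hT
  have hπ : 2 ≤ Real.pi := Real.two_le_pi
  have hq_pos : ∀ k : ℕ, 0 < 1 / ((k : ℝ) + 2) := fun k => by positivity
  have hq_le : ∀ k : ℕ, 1 / ((k : ℝ) + 2) ≤ 1 / 2 := fun k =>
    one_div_le_one_div_of_le (by norm_num) (by have : (0 : ℝ) ≤ k := Nat.cast_nonneg k; linarith)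
  -- membership in a piece, unfolded
  have hmemB : ∀ {k : ℕ} {x : ℝ}, x ∈ B k ↔ x - c k ∈ V := fun {k} {x} => by
    simp only [hB, mem_preimage, ← sub_eq_add_neg]
  refine ⟨(fun t : ℝ => (t : ℂ) * Complex.I) '' T, ?_, ?_, ?_⟩
  · -- `S ⊆ iℝ`
    rintro _ ⟨t, -, rfl⟩
    simp
  · -- injectivity of `exp` on `S`
    rintro _ ⟨a, ha, rfl⟩ _ ⟨b, hb, rfl⟩ hexp
    obtain ⟨n, hn⟩ := Complex.exp_eq_exp_iff_exists_int.1 hexp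
    have hab : a = b + n * (2 * Real.pi) := by
      have := congrArg Complex.im hn
      simpa using this
    obtain ⟨k, hk⟩ := mem_iUnion.1 ha
    obtain ⟨j, hj⟩ := mem_iUnion.1 hb
    have hv := hmemB.1 hk
    have hw := hmemB.1 hj
    have hvI := hVI hv
    have hwI := hVI hw
    rw [mem_Ioo] at hvI hwI
    -- the `2πℤ`-part vanishes: `m := j - k + n = 0`
    have hm : ((j : ℤ) - k + n : ℤ) = 0 := by
      by_contra hm
      have hm1 : (1 : ℝ) ≤ |(((j : ℤ) - k + n : ℤ) : ℝ)| := by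
        rw [← Int.cast_abs]; exact_mod_cast Int.one_le_abs hm
      -- the identity `(a - c k) - (b - c j) + (q_k - q_j) = 2π m`
      have hid : (a - c k) - (b - c j) + (1 / ((k : ℝ) + 2) - 1 / ((j : ℝ) + 2))
          = 2 * Real.pi * (((j : ℤ) - k + n : ℤ) : ℝ) := by
        push_cast
        rw [hab, hc]
        ring
      have hlt : |(a - c k) - (b - c j) + (1 / ((k : ℝ) + 2) - 1 / ((j : ℝ) + 2))| < 2 := by
        rw [abs_lt]
        have h1 := hq_pos k; have h2 := hq_pos j; have h3 := hq_le k; have h4 := hq_le j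
        constructor <;> nlinarith
      rw [hid, abs_mul, abs_of_pos (by positivity : (0 : ℝ) < 2 * Real.pi)] at hlt
      nlinarith
    -- hence `w - v ∈ ℚ`, so `w = v`
    have hvw : b - c j = (a - c k) + ((1 / ((k : ℚ) + 2) - 1 / ((j : ℚ) + 2) : ℚ) : ℝ) := by
      have hm' : (((j : ℤ) - k + n : ℤ) : ℝ) = 0 := by exact_mod_cast hm
      push_cast
      have : (n : ℝ) = (k : ℝ) - j := by push_cast at hm'; linarith
      rw [hab, hc, this]
      ring
    have heq : b - c j = a - c k := huniq _ hv _ hw _ hvw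
    -- so `q_k = q_j`, `k = j`, `n = 0`, `a = b`
    have hqq : 1 / ((k : ℝ) + 2) = 1 / ((j : ℝ) + 2) := by
      have := hvw; rw [heq] at this; push_cast at this; linarith
    have hkj : (k : ℝ) = j := by
      have h1 : (k : ℝ) + 2 ≠ 0 := by positivity
      have h2 : (j : ℝ) + 2 ≠ 0 := by positivity
      field_simp at hqq
      linarith
    have hkj' : k = j := by exact_mod_cast hkj
    subst hkj'
    have hn0 : (n : ℝ) = 0 := by
      have hm' : (((k : ℤ) - k + n : ℤ) : ℝ) = 0 := by exact_mod_cast hm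
      push_cast at hm'; linarith
    have : a = b := by rw [hab, hn0]; ring
    rw [this]
  · -- `volume (im '' S) = ∞`
    have himage : Complex.im '' ((fun t : ℝ => (t : ℂ) * Complex.I) '' T) = T := by
      rw [Set.image_image]
      convert Set.image_id T using 2 with t
      simp
    rw [himage]
    -- the windows `W k = [2πk, 2πk + 2)`
    set W : ℕ → Set ℝ := fun k => Ico (2 * Real.pi * k) (2 * Real.pi * k + 2) with hW
    have hWmeas : ∀ k, MeasurableSet (W k) := fun k => measurableSet_Ico
    have hWdisj : Pairwise (Function.onFun Disjoint W) := by
      intro k j hkj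
      rcases lt_or_gt_of_ne hkj with h | h
      · refine Set.disjoint_left.2 fun x hxk hxj => ?_
        rw [hW, mem_Ico] at hxk hxj
        have : (k : ℝ) + 1 ≤ j := by exact_mod_cast h
        nlinarith
      · refine Set.disjoint_left.2 fun x hxk hxj => ?_
        rw [hW, mem_Ico] at hxk hxj
        have : (j : ℝ) + 1 ≤ k := by exact_mod_cast h
        nlinarith
    have hBW : ∀ k, B k ⊆ W k := fun k x hx => by
      have hv := hVI (hmemB.1 hx)
      rw [mem_Ioo] at hv
      rw [hW, mem_Ico]
      have h1 := hq_pos k; have h2 := hq_le k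
      constructor <;> linarith
    -- each piece has the outer measure of `V`
    have hBvol : ∀ k, volume (B k) = volume V := fun k => by
      rw [hB]; dsimp only; rw [measure_preimage_add_right]
    -- lower bound through the restricted measure on the disjoint measurable windows
    have hle : (∑' k : ℕ, volume V) ≤ volume T := by
      calc (∑' k : ℕ, volume V) = ∑' k : ℕ, volume (B k) := by simp_rw [hBvol]
        _ ≤ ∑' k : ℕ, volume.restrict T (W k) := ENNReal.tsum_le_tsum fun k => by
            rw [Measure.restrict_apply (hWmeas k)]
            exact measure_mono fun x hx => ⟨hBW k hx, mem_iUnion.2 ⟨k, hx⟩⟩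
        _ = volume.restrict T (⋃ k, W k) := (measure_iUnion hWdisj hWmeas).symm
        _ ≤ volume.restrict T univ := measure_mono (subset_univ _)
        _ = volume T := Measure.restrict_apply_univ _
    rw [ENNReal.tsum_const_eq_top_of_ne_zero hVpos] at hle
    exact le_antisymm le_top hle

/-! ### 3. The literal F-0432 fails along `(iℝ, exp, Lebesgue)` for every finite-valued angular volume -/

/-- Along `L := iℝ`, `expk := exp`, `volLin := volume ∘ (im '' ·)` (Lebesgue measure along `iℝ`), the
literal F-0432 `Remark394vi_expPreservesVolume` fails for EVERY candidate angular volume `volAng` that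
never takes the value `∞` — in particular for every real-valued one: the witness of
`exists_injOn_exp_volume_im_eq_top` has `volLin = ∞`. ([IUTchIII] Rmk 3.9.4 (vi) p.125, literal typing)
[claim: Mochizuki2012, status: disputed] -/
theorem not_Remark394vi_expPreservesVolume_imAxis_of_ne_top (volAng : Set ℂ → ℝ≥0∞)
    (hfin : ∀ A, volAng A ≠ ⊤) :
    ¬ Remark394vi_expPreservesVolume {z : ℂ | z.re = 0} Complex.exp volAng
      (fun S => volume (Complex.im '' S)) := by
  intro h
  obtain ⟨S, hSL, hinj, htop⟩ := exists_injOn_exp_volume_im_eq_top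
  have h1 : volAng (Complex.exp '' S) = volume (Complex.im '' S) := h S hSL hinj
  exact hfin _ (h1.trans htop)

/-! ### 4. The archimedean model of record: F-0432 DECIDED -/

/-- The angular volume `μ̆_k(A)` of [AbsTopIII] Prop. 5.7 (ii)(a) (abc-iut-L4-t3 `ComplexVolume.angularVolume`:
the Haar measure of mass `2π` on `𝒪^×_k = ℝ/2πℤ` of the phase-image, as a real number) is bounded by `2π`
for EVERY `A ⊆ ℂ`. [cite: MochizukiAbsTopIII2015, Prop 5.7 (ii)(a) p. 138] -/
theorem angularVolume_le_two_pi (A : Set ℂ) : ComplexVolume.angularVolume A ≤ 2 * Real.pi := by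
  haveI : Fact (0 < 2 * Real.pi) := ⟨Real.two_pi_pos⟩
  unfold ComplexVolume.angularVolume
  have huniv : volume (univ : Set (AddCircle (2 * Real.pi))) = ENNReal.ofReal (2 * Real.pi) :=
    AddCircle.measure_univ _
  calc (volume (ComplexVolume.phase '' A)).toReal
      ≤ (volume (univ : Set (AddCircle (2 * Real.pi)))).toReal :=
        ENNReal.toReal_mono (by rw [huniv]; exact ENNReal.ofReal_ne_top) (measure_mono (subset_univ _))
    _ = 2 * Real.pi := by rw [huniv, ENNReal.toReal_ofReal Real.two_pi_pos.le]

/-- **IUTchIII:Rmk3.9.4(vi), LITERAL typing F-0432 — REFUTED AT THE ARCHIMEDEAN MODEL OF RECORD**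
(kurims p.125 l.36 – p.126 l.40): with `k = ℂ`, `L := log_k(𝒪^×_k) = iℝ`, `expk := exp`,
`volAng := ENNReal.ofReal ∘ μ̆_k` (abc-iut-L4-t3's `ComplexVolume.angularVolume`) and `volLin :=` Lebesgue measure
along `iℝ` — EXACTLY the instantiation at which the corrected row `Remark394vi_expPreservesVolume'` is PROVED
(`Remark394vi_expPreservesVolume'_holds`, p407046) — the hypothesis-free row
`Remark394vi_expPreservesVolume` (RealifiedSemisimplification.lean:342, the typer's recorded mis-typing) is
FALSE: the Vitali witness `S ⊆ iℝ` has `exp` injective on `S`, `volLin S = ∞`, `volAng (exp S) ≤ 2π`.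
FACT row F-0432, literal form: REFUTED-AT-MODEL. [claim: Mochizuki2012, status: disputed] -/
theorem not_Remark394vi_expPreservesVolume_arch :
    ¬ Remark394vi_expPreservesVolume {z : ℂ | z.re = 0} Complex.exp
      (fun A => ENNReal.ofReal (ComplexVolume.angularVolume A)) (fun S => volume (Complex.im '' S)) :=
  not_Remark394vi_expPreservesVolume_imAxis_of_ne_top _ fun _ => ENNReal.ofReal_ne_top

/-- Hence the universal closure of the literal schema F-0432 over all data `(k, L, expk, volAng, volLin)` is
FALSE (FACT-LIST rule: a schema is not a fact; its instance forms are the content).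
([IUTchIII] Rmk 3.9.4 (vi) p.125, literal typing) [claim: Mochizuki2012, status: disputed] -/
theorem not_forall_Remark394vi_expPreservesVolume :
    ¬ ∀ (k : Type) (L : Set k) (expk : k → k) (volAng volLin : Set k → ℝ≥0∞),
      Remark394vi_expPreservesVolume L expk volAng volLin :=
  fun h => not_Remark394vi_expPreservesVolume_arch (h ℂ _ _ _ _)

/-- **F-0432 DECIDED at the archimedean model of record** ([IUTchIII] Rmk 3.9.4 (vi), kurims pp.125–126):
the CORRECTED typing `Remark394vi_expPreservesVolume'` (compact = print's "ample" `S`) HOLDS there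
(abc-iut-L6-d4, p407046) AND the LITERAL typing `Remark394vi_expPreservesVolume` (no hypothesis on `S`) FAILS
there (this file).  The compactness / measurability binder of the corrected row is therefore LOAD-BEARING.
[claim: Mochizuki2012, status: disputed] -/
theorem Remark394vi_label_decided_arch :
    Remark394vi_expPreservesVolume' {z : ℂ | z.re = 0} Complex.exp
        (fun A => ENNReal.ofReal (ComplexVolume.angularVolume A)) (fun S => volume (Complex.im '' S)) ∧
      ¬ Remark394vi_expPreservesVolume {z : ℂ | z.re = 0} Complex.exp
        (fun A => ENNReal.ofReal (ComplexVolume.angularVolume A)) (fun S => volume (Complex.im '' S)) :=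
  ⟨Remark394vi_expPreservesVolume'_holds, not_Remark394vi_expPreservesVolume_arch⟩

end Literature.IUT.LogThetaLattice

end
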